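import Literature.Analysis.FluidPDE.PineauVicolCylinderRegularity
import Literature.Analysis.FluidPDE.TaoEnstrophyLocalisation
import HarnessLib

/-!
# Route CorkscrewDynamo · crux `CorkscrewProfile` (stmt-NavierStokesRegularity-11282) — tool stub V4: Type-I decay of the first two derivatives of the slice `u(−1,·)` of a classical Type-I solution

Tool stub `stub_typeIDerivativeDecay` of line `registered` (skeleton v13, lead c6): the profile
`U = u(−1)` of a rotating self-similar Type-I ancient solution is the slice of a classical
Type-I solution `(u, p)` of Navier–Stokes (`ν = 1`, `f = 0`) on `(−∞, 0)`,
`|u(x,t)| ≤ C₀/(|x| + √(−t))`, and the lead's vertical-vorticity flux identity needs the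
TYPE-I DECAY OF DERIVATIVES at `t = −1`: `‖DU(x)‖ ≤ K(1+‖x‖)⁻²`, `‖D(curl U)(x)‖ ≤ K(1+‖x‖)⁻³`.
Pineau–Vicol 2026, Lemma 7.1 in physical variables (all inputs proved in the tree's discharge
files): `exists_forall_iteratedFDeriv_le_of_typeI` with `n = 1, 2` gives
`‖Dⁿu(−1)(x)‖ ≤ Kₙ · max{‖x‖, √1}^{−(n+1)}`; since `1 + ‖x‖ ≤ 2 max{‖x‖, 1}`,
`max{‖x‖,1}^{−k} ≤ 2ᵏ(1+‖x‖)^{−k}`; `‖D¹u‖ = ‖Du‖` (`norm_iteratedFDeriv_one`) and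
`‖D(curl U)‖ ≤ ‖curlCLM‖ ‖D²U‖` (`norm_fderiv_curl_le`). One constant
`K := 4K₁ + 8‖curlCLM‖K₂` serves both bounds.
-/

noncomputable section

open MeasureTheory Set Function Filter Topology InnerProductSpace Metric
open Literature.Analysis.FluidPDE Literature.Analysis.FluidPDE.PineauVicol2026
open scoped RealInnerProductSpace Laplacian ContDiff NNReal ENNReal

namespace Summit.NavierStokesRegularity.NavierStokesRegularity.Theorems.CorkscrewProfile.Birth

set_option linter.dupNamespace false

-- nested operator types
set_option maxSynthPendingDepth 3

/-- **Elementary comparison of the two decay weights**: for `r ≥ 0` and every `k`,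
`(max{r, 1})^{−k} ≤ 2ᵏ/(1+r)ᵏ`, because `1 + r ≤ 2 max{r, 1}`. [folklore] -/
theorem typeIDerivativeDecay_max_inv_pow_le {r : ℝ} (hr : 0 ≤ r) (k : ℕ) :
    ((max r 1)⁻¹) ^ k ≤ 2 ^ k / (1 + r) ^ k := by
  have hm : 0 < max r 1 := lt_max_of_lt_right one_pos
  have hd : 0 < 1 + r := by positivity
  have h1 : 1 + r ≤ 2 * max r 1 := by
    have ha := le_max_left r 1
    have hb := le_max_right r 1
    linarith
  have h2 : (max r 1)⁻¹ ≤ 2 / (1 + r) := by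
    rw [inv_eq_one_div, div_le_div_iff₀ hm hd, one_mul]
    exact h1
  calc ((max r 1)⁻¹) ^ k ≤ (2 / (1 + r)) ^ k := pow_le_pow_left₀ (by positivity) h2 k
    _ = 2 ^ k / (1 + r) ^ k := div_pow 2 (1 + r) k

/-- **Stub V4 `stub_typeIDerivativeDecay` (Pineau–Vicol 2026, Lemma 7.1, physical variables at
`t = −1`).** For a classical solution `(u, p)` of Navier–Stokes (`ν = 1`, `f = 0`) on `(−∞, 0)`
with the Type-I bound `|u(x,t)| ≤ C₀/(|x| + √(−t))` and `u(−1) ∈ C²`, the first two derivatives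
of the slice `u(−1)` have Type-I decay: `‖Du(−1)(x)‖ ≤ K/(1+‖x‖)²` and
`‖D(curl u(−1))(x)‖ ≤ K/(1+‖x‖)³` for one `K ≥ 0` (`exists_forall_iteratedFDeriv_le_of_typeI`
for `n = 1, 2` at `t = −1`, where `√(−(−1)) = 1` and `max{‖x‖, 1}^{−k} ≤ 2ᵏ(1+‖x‖)^{−k}`;
`‖iteratedFDeriv 1‖ = ‖fderiv‖`, `norm_fderiv_curl_le`; `K = 4K₁ + 8‖curlCLM‖K₂`).
[cite: PineauVicol2026, Lemma 7.1] -/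
theorem stub_typeIDerivativeDecay {C₀ : ℝ}
    {u : ℝ → EuclideanSpace ℝ (Fin 3) → EuclideanSpace ℝ (Fin 3)} {p : ℝ → EuclideanSpace ℝ (Fin 3) → ℝ}
    (hsol : IsClassicalNSSolutionOn (Set.Iio 0) 1 0 u p)
    (hI : ∀ t ∈ Set.Iio (0 : ℝ), ∀ x : EuclideanSpace ℝ (Fin 3), ‖u t x‖ ≤ C₀ / (‖x‖ + Real.sqrt (-t)))
    (h2 : ContDiff ℝ 2 (u (-1))) :
    ∃ K : ℝ, 0 ≤ K ∧ ∀ x : EuclideanSpace ℝ (Fin 3),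
      ‖fderiv ℝ (u (-1)) x‖ ≤ K / (1 + ‖x‖) ^ 2 ∧ ‖fderiv ℝ (curl (u (-1))) x‖ ≤ K / (1 + ‖x‖) ^ 3 := by
  obtain ⟨K₁, hK₁0, hK₁⟩ := exists_forall_iteratedFDeriv_le_of_typeI 1 C₀
  obtain ⟨K₂, hK₂0, hK₂⟩ := exists_forall_iteratedFDeriv_le_of_typeI 2 C₀
  set κ : ℝ := ‖curlCLM‖ with hκ
  have hκ0 : 0 ≤ κ := norm_nonneg _
  refine ⟨4 * K₁ + 8 * κ * K₂, by positivity, fun x => ?_⟩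
  have h1 : (-1 : ℝ) ∈ Iio (0 : ℝ) := by norm_num
  have hs1 : Real.sqrt (-(-1 : ℝ)) = 1 := by rw [neg_neg, Real.sqrt_one]
  have hr : 0 ≤ ‖x‖ := norm_nonneg x
  have hd : 0 < 1 + ‖x‖ := by positivity
  -- the engine at `t = −1`, orders `1` and `2`
  have e1 : ‖fderiv ℝ (u (-1)) x‖ ≤ K₁ * ((max ‖x‖ 1)⁻¹) ^ 2 := by
    have h := hK₁ u p hsol hI (-1) h1 x
    rw [hs1, norm_iteratedFDeriv_one] at h
    exact h
  have e2 : ‖iteratedFDeriv ℝ 2 (u (-1)) x‖ ≤ K₂ * ((max ‖x‖ 1)⁻¹) ^ 3 := by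
    have h := hK₂ u p hsol hI (-1) h1 x
    rw [hs1] at h
    exact h
  have hm2 : ((max ‖x‖ 1)⁻¹) ^ 2 ≤ 2 ^ 2 / (1 + ‖x‖) ^ 2 := typeIDerivativeDecay_max_inv_pow_le hr 2
  have hm3 : ((max ‖x‖ 1)⁻¹) ^ 3 ≤ 2 ^ 3 / (1 + ‖x‖) ^ 3 := typeIDerivativeDecay_max_inv_pow_le hr 3
  refine ⟨?_, ?_⟩
  · -- first derivative: `‖Du(−1)(x)‖ ≤ 4K₁/(1+‖x‖)²`
    calc ‖fderiv ℝ (u (-1)) x‖ ≤ K₁ * ((max ‖x‖ 1)⁻¹) ^ 2 := e1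
      _ ≤ K₁ * (2 ^ 2 / (1 + ‖x‖) ^ 2) := mul_le_mul_of_nonneg_left hm2 hK₁0
      _ = (4 * K₁) / (1 + ‖x‖) ^ 2 := by ring
      _ ≤ (4 * K₁ + 8 * κ * K₂) / (1 + ‖x‖) ^ 2 :=
        div_le_div_of_nonneg_right (le_add_of_nonneg_right (by positivity)) (by positivity)
  · -- vorticity gradient: `‖D(curl u(−1))(x)‖ ≤ κ‖D²u(−1)(x)‖ ≤ 8κK₂/(1+‖x‖)³`
    calc ‖fderiv ℝ (curl (u (-1))) x‖ ≤ κ * ‖iteratedFDeriv ℝ 2 (u (-1)) x‖ :=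
          norm_fderiv_curl_le h2 x
      _ ≤ κ * (K₂ * ((max ‖x‖ 1)⁻¹) ^ 3) := mul_le_mul_of_nonneg_left e2 hκ0
      _ ≤ κ * (K₂ * (2 ^ 3 / (1 + ‖x‖) ^ 3)) :=
        mul_le_mul_of_nonneg_left (mul_le_mul_of_nonneg_left hm3 hK₂0) hκ0
      _ = (8 * κ * K₂) / (1 + ‖x‖) ^ 3 := by ring
      _ ≤ (4 * K₁ + 8 * κ * K₂) / (1 + ‖x‖) ^ 3 :=
        div_le_div_of_nonneg_right (le_add_of_nonneg_left (by positivity)) (by positivity)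

end Summit.NavierStokesRegularity.NavierStokesRegularity.Theorems.CorkscrewProfile.Birth
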